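import Mathlib.NumberTheory.ModularForms.QExpansion
import Mathlib.RingTheory.RootsOfUnity.Complex
import Summits.Langlands.Langlands.Theorems.CapacityClassicalityCongruenceToClassicalDefs

/-!
# The `T_ℓ`-eigenvalue relation on coefficients gives the Hecke functional equation

Helper file for `CongruenceToClassical` (route CapacityClassicality, item stmt-Langlands-10367).
If `G : ℍ → ℂ` is given on all of `ℍ` by a convergent `q`-series `G τ = ∑ g n qⁿ`
(`q = exp (2πiτ)`) whose coefficients satisfy the `T_ℓ`-eigenvalue relation
`g (ℓ n) + [ℓ ∣ n] ψℓ ℓ^(k-1) g (n/ℓ) = g ℓ · g n` for all `n ≥ 1`, then `G` satisfies the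
functional equation
`∑_{j<ℓ} G ∣[k] [[1,j],[0,ℓ]] + ψℓ · G ∣[k] [[ℓ,0],[0,1]] = g ℓ · G + c₀`
with the constant `c₀ = g 0 (1 + ψℓ ℓ^(k-1) - g ℓ)` (the relation is not assumed at `n = 0`).
This is the usual computation `U_ℓ (∑ g n qⁿ) = ∑ g (ℓ n) qⁿ`, `V_ℓ (∑ g n qⁿ) = ∑ g n q^(ℓ n)`
with `∑_{j<ℓ} ζ^(n j) = ℓ [ℓ ∣ n]` for `ζ = exp (2πi/ℓ)`.
-/

set_option linter.dupNamespace false -- project-wide option (lakefile weak.linter.dupNamespace); `Summit.Langlands.Langlands` is the mandated namespace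

noncomputable section

open Complex Filter UpperHalfPlane Function ModularForm

open scoped Real Topology MatrixGroups ModularForm

open Function.Periodic (qParam)

namespace Summit.Langlands.Langlands.Theorems.CapacityClassicality

section

variable {ℓ : ℕ} [NeZero ℓ]

/-- `q (βV ℓ • τ) = q τ ^ ℓ`. -/
lemma qParam_βV_smul (τ : ℍ) : qParam 1 ((βV ℓ • τ : ℍ) : ℂ) = qParam 1 (τ : ℂ) ^ ℓ := by
  rw [coe_βV_smul, qParam, qParam, ← Complex.exp_nat_mul]
  congr 1
  push_cast
  ring

/-- `q (βU ℓ j • τ) = ζ ^ j * q_ℓ τ` with `ζ = exp (2πi/ℓ)` and `q_ℓ τ = exp (2πiτ/ℓ)`. -/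
lemma qParam_βU_smul (j : ℕ) (τ : ℍ) :
    qParam 1 ((βU ℓ (j : ℤ) • τ : ℍ) : ℂ) = Complex.exp (2 * π * Complex.I / ℓ) ^ j * qParam ℓ (τ : ℂ) := by
  rw [coe_βU_smul, qParam, qParam, ← Complex.exp_nat_mul, ← Complex.exp_add]
  congr 1
  push_cast
  have : (ℓ : ℂ) ≠ 0 := by exact_mod_cast NeZero.ne ℓ
  field_simp
  ring

/-- `q_ℓ τ ^ ℓ = q τ`. -/
lemma qParam_ℓ_pow (τ : ℍ) : qParam ℓ (τ : ℂ) ^ ℓ = qParam 1 (τ : ℂ) := by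
  rw [qParam, qParam, ← Complex.exp_nat_mul]
  congr 1
  have : (ℓ : ℂ) ≠ 0 := by exact_mod_cast NeZero.ne ℓ
  push_cast
  field_simp

/-- The character sum `∑_{j<ℓ} ζ ^ (n j)` equals `ℓ` if `ℓ ∣ n` and `0` otherwise. -/
lemma sum_root_of_unity_pow (n : ℕ) :
    ∑ j ∈ Finset.range ℓ, (Complex.exp (2 * π * Complex.I / ℓ) ^ j) ^ n =
      if ℓ ∣ n then (ℓ : ℂ) else 0 := by
  have hprim : IsPrimitiveRoot (Complex.exp (2 * π * Complex.I / ℓ)) ℓ :=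
    Complex.isPrimitiveRoot_exp ℓ (NeZero.ne ℓ)
  have hswap : ∀ j : ℕ, (Complex.exp (2 * π * Complex.I / ℓ) ^ j) ^ n =
      (Complex.exp (2 * π * Complex.I / ℓ) ^ n) ^ j := fun j ↦ by rw [← pow_mul, ← pow_mul, Nat.mul_comm]
  simp_rw [hswap]
  split_ifs with h
  · rw [(hprim.pow_eq_one_iff_dvd n).mpr h]
    simp
  · have hne : Complex.exp (2 * π * Complex.I / ℓ) ^ n ≠ 1 := fun h1 ↦ h ((hprim.pow_eq_one_iff_dvd n).mp h1)
    rw [geom_sum_eq hne, ← pow_mul, pow_mul', hprim.pow_eq_one, one_pow, sub_self, zero_div]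

end

/-- **The Hecke functional equation from the coefficient relation.** -/
theorem hecke_relation_of_coeff {ℓ : ℕ} [NeZero ℓ] {k : ℤ} {ψℓ : ℂ} {g : ℕ → ℂ} {G : ℍ → ℂ}
    (hG : ∀ τ : ℍ, HasSum (fun n ↦ g n * qParam 1 τ ^ n) (G τ))
    (hrel : ∀ n : ℕ, 0 < n →
      g (ℓ * n) + (if ℓ ∣ n then ψℓ * (ℓ : ℂ) ^ (k - 1) * g (n / ℓ) else 0) = g ℓ * g n)
    (τ : ℍ) :
    ∑ j ∈ Finset.range ℓ, (G ∣[k] βU ℓ (j : ℤ)) τ + ψℓ * (G ∣[k] βV ℓ) τ =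
      g ℓ * G τ + g 0 * (1 + ψℓ * (ℓ : ℂ) ^ (k - 1) - g ℓ) := by
  classical
  have hℓ0 : (ℓ : ℂ) ≠ 0 := by exact_mod_cast NeZero.ne ℓ
  have hℓpos : 0 < ℓ := Nat.pos_of_ne_zero (NeZero.ne ℓ)
  set q : ℂ := qParam 1 (τ : ℂ) with hq
  set Q : ℂ := qParam ℓ (τ : ℂ) with hQ
  set ζ : ℂ := Complex.exp (2 * π * Complex.I / ℓ) with hζ
  have hQq : Q ^ ℓ = q := qParam_ℓ_pow τ
  -- (U) the sum over `j` of `G (βU j • τ)`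
  have hUj : ∀ j ∈ Finset.range ℓ,
      HasSum (fun n ↦ g n * Q ^ n * (ζ ^ j) ^ n) (G (βU ℓ (j : ℤ) • τ)) := by
    intro j _
    have h1 := hG (βU ℓ (j : ℤ) • τ)
    rw [qParam_βU_smul] at h1
    have heq : (fun n ↦ g n * (Complex.exp (2 * π * Complex.I / ℓ) ^ j * qParam ℓ (τ : ℂ)) ^ n) =
        fun n ↦ g n * Q ^ n * (ζ ^ j) ^ n := by
      funext n; rw [mul_pow]; ring
    rwa [heq] at h1
  have hU : HasSum (fun n ↦ if ℓ ∣ n then (ℓ : ℂ) * (g n * Q ^ n) else 0)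
      (∑ j ∈ Finset.range ℓ, G (βU ℓ (j : ℤ) • τ)) := by
    have h1 := hasSum_sum hUj
    have heq : (fun n ↦ ∑ j ∈ Finset.range ℓ, g n * Q ^ n * (ζ ^ j) ^ n) =
        fun n ↦ if ℓ ∣ n then (ℓ : ℂ) * (g n * Q ^ n) else 0 := by
      funext n
      rw [← Finset.mul_sum, sum_root_of_unity_pow]
      split_ifs <;> ring
    rwa [heq] at h1
  -- reindex along `n ↦ ℓ n`
  have hinj : Function.Injective (fun n : ℕ ↦ ℓ * n) := mul_right_injective₀ (NeZero.ne ℓ)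
  have hrange : ∀ x : ℕ, x ∉ Set.range (fun n : ℕ ↦ ℓ * n) → ¬ ℓ ∣ x := by
    rintro x hx ⟨c, rfl⟩
    exact hx ⟨c, rfl⟩
  have hU' : HasSum (fun n ↦ (ℓ : ℂ) * (g (ℓ * n) * q ^ n))
      (∑ j ∈ Finset.range ℓ, G (βU ℓ (j : ℤ) • τ)) := by
    rw [← hinj.hasSum_iff (fun x hx ↦ by simp [hrange x hx])] at hU
    have heq : ((fun n ↦ if ℓ ∣ n then (ℓ : ℂ) * (g n * Q ^ n) else 0) ∘ fun n : ℕ ↦ ℓ * n) =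
        fun n ↦ (ℓ : ℂ) * (g (ℓ * n) * q ^ n) := by
      funext n
      simp only [Function.comp_apply, dvd_mul_right, if_true, pow_mul, hQq]
    rwa [heq] at hU
  -- (V) the term `G (βV • τ)`
  have hV : HasSum (fun n ↦ g n * q ^ (ℓ * n)) (G (βV ℓ • τ)) := by
    have h1 := hG (βV ℓ • τ)
    rw [qParam_βV_smul] at h1
    have heq : (fun n ↦ g n * (qParam 1 (τ : ℂ) ^ ℓ) ^ n) = fun n ↦ g n * q ^ (ℓ * n) := by
      funext n; rw [← pow_mul]
    rwa [heq] at h1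
  have hV' : HasSum (fun n ↦ if ℓ ∣ n then g (n / ℓ) * q ^ n else 0) (G (βV ℓ • τ)) := by
    rw [← hinj.hasSum_iff (fun x hx ↦ by simp [hrange x hx])]
    have heq : ((fun n ↦ if ℓ ∣ n then g (n / ℓ) * q ^ n else 0) ∘ fun n : ℕ ↦ ℓ * n) =
        fun n ↦ g n * q ^ (ℓ * n) := by
      funext n
      simp only [Function.comp_apply, dvd_mul_right, if_true, Nat.mul_div_cancel_left _ hℓpos]
    rwa [heq]
  -- the left-hand side as a single `q`-series
  have hLHS : HasSum (fun n ↦ (g (ℓ * n) + (if ℓ ∣ n then ψℓ * (ℓ : ℂ) ^ (k - 1) * g (n / ℓ)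
      else 0)) * q ^ n)
      (∑ j ∈ Finset.range ℓ, (G ∣[k] βU ℓ (j : ℤ)) τ + ψℓ * (G ∣[k] βV ℓ) τ) := by
    have h1 : HasSum (fun n ↦ g (ℓ * n) * q ^ n)
        (∑ j ∈ Finset.range ℓ, (G ∣[k] βU ℓ (j : ℤ)) τ) := by
      have hsum : ∑ j ∈ Finset.range ℓ, (G ∣[k] βU ℓ (j : ℤ)) τ =
          (∑ j ∈ Finset.range ℓ, G (βU ℓ (j : ℤ) • τ)) / ℓ := by
        rw [Finset.sum_div]
        exact Finset.sum_congr rfl fun j _ ↦ slash_βU_apply _ _ _ _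
      rw [hsum]
      have h2 := hU'.div_const (ℓ : ℂ)
      have heq : (fun n ↦ (ℓ : ℂ) * (g (ℓ * n) * q ^ n) / ℓ) = fun n ↦ g (ℓ * n) * q ^ n := by
        funext n; field_simp
      rwa [heq] at h2
    have h2 : HasSum (fun n ↦ (if ℓ ∣ n then ψℓ * (ℓ : ℂ) ^ (k - 1) * g (n / ℓ) else 0) * q ^ n)
        (ψℓ * (G ∣[k] βV ℓ) τ) := by
      have h3 := hV'.mul_left (ψℓ * (ℓ : ℂ) ^ (k - 1))
      rw [slash_βV_apply, ← mul_assoc]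
      have heq : (fun n ↦ ψℓ * (ℓ : ℂ) ^ (k - 1) * (if ℓ ∣ n then g (n / ℓ) * q ^ n else 0)) =
          fun n ↦ (if ℓ ∣ n then ψℓ * (ℓ : ℂ) ^ (k - 1) * g (n / ℓ) else 0) * q ^ n := by
        funext n; split_ifs <;> ring
      rwa [heq] at h3
    have h3 := h1.add h2
    have heq : (fun n ↦ g (ℓ * n) * q ^ n +
        (if ℓ ∣ n then ψℓ * (ℓ : ℂ) ^ (k - 1) * g (n / ℓ) else 0) * q ^ n) =
        fun n ↦ (g (ℓ * n) + (if ℓ ∣ n then ψℓ * (ℓ : ℂ) ^ (k - 1) * g (n / ℓ) else 0)) * q ^ n := by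
      funext n; ring
    rwa [heq] at h3
  -- the right-hand side as a single `q`-series
  have hRHS : HasSum (fun n ↦ (g (ℓ * n) + (if ℓ ∣ n then ψℓ * (ℓ : ℂ) ^ (k - 1) * g (n / ℓ)
      else 0)) * q ^ n)
      (g ℓ * G τ + g 0 * (1 + ψℓ * (ℓ : ℂ) ^ (k - 1) - g ℓ)) := by
    have h1 : HasSum (fun n ↦ g ℓ * (g n * q ^ n)) (g ℓ * G τ) := (hG τ).mul_left _
    have h2 : HasSum (fun n : ℕ ↦ if n = 0 then g 0 * (1 + ψℓ * (ℓ : ℂ) ^ (k - 1) - g ℓ) else 0)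
        (g 0 * (1 + ψℓ * (ℓ : ℂ) ^ (k - 1) - g ℓ)) := hasSum_ite_eq 0 _
    have h3 := h1.add h2
    have heq : (fun n : ℕ ↦ g ℓ * (g n * q ^ n) +
        (if n = 0 then g 0 * (1 + ψℓ * (ℓ : ℂ) ^ (k - 1) - g ℓ) else 0)) =
        fun n ↦ (g (ℓ * n) + (if ℓ ∣ n then ψℓ * (ℓ : ℂ) ^ (k - 1) * g (n / ℓ) else 0)) *
          q ^ n := by
      funext n
      rcases Nat.eq_zero_or_pos n with rfl | hn
      · simp
        ring
      · rw [if_neg hn.ne', hrel n hn]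
        ring
    rwa [heq] at h3
  exact hLHS.unique hRHS

end Summit.Langlands.Langlands.Theorems.CapacityClassicality
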